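import Summits.QuantumFields.YangMills.Theorems.UnitScaleTiltProp7PcolOperatorReduction
import Summits.QuantumFields.YangMills.Theorems.UnitScaleTiltProp7KernelColumnRowDuality
import Summits.QuantumFields.YangMills.Theorems.UnitScaleTiltProp7KerDProjSupBound
import Summits.QuantumFields.YangMills.Theorems.UnitScaleTiltProp7ComplementaryProjectorSourceForm
import HarnessLib

/-!
# Route `UnitScaleTilt`, crux K1 «MinimiserStabilityRegPr» (stmt-QuantumFields-19200), EX face S44ᴸγ∕S45, row `hPcol` — **P4: THE KNIT.  `hPcol`'s display at one member
# from ONE gradient letter (T1: `‖D_{U₀}G_a f‖_∞ ≤ R₁‖f‖_∞`) and ONE value letter (`‖G_a f‖_∞ ≤ B_∞‖f‖_∞`) of the LOD propagator on GENERAL bounded sources** (LOCATE-hPcol v2 42098c54,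
# 19200 evidence #54): the operator identity `R_S G′ᴾ g = G_a(g′ − T c(G_a g′))`, `g′ = (1 − P₀)g` (§1), the sup letters of P4b ∕ P3v (§2), P4a's column∕row duality (§3).

Cell `ym3-torus` (HUMAN RULING D-0037; rung R3 = SU(2) YM₃ on T³ — NOT d = 4, NOT infinite volume, NOT a mass gap, NOT Clay).  Width seat `ym3-torus-px5` (gen 13).
THEOREMS ONLY (0 `def`, 0 `sorry`, default heartbeats); `--supports stmt-QuantumFields-19200 --as helper`; count-neutral.

WHY.  P4a ✓`sum_norm_GprimeP_RS_DstarL2_single_le_of_gradient_row` turns the EX row `hPcol` (✓`minimiserStabilityRegPr_of_EXrowsS44LG` :243–252, an `ℓ¹` COLUMN sum of the kernel of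
`G′ᴾ R_S D*_{U₀}`) into ONE `ℓ^∞ → ℓ^∞` ROW letter for the gradient operator `D_{U₀} R_S G′ᴾ`.  §1 computes that operator under the Lift antecedent (`R_S = projR Δ^η Q″`, `ker Q″ ≤ N_S`):
the LOD propagator `G = G_a` is SYMMETRIC (two-sided inverse of the symmetric `Δ^η_{U₀} + a·TιQ″`, `T = (ιQ″)†` by `hT`; ✓`isSymmetric_covLapSite`), so the adjoint of P1
✓`GprimeP_RS_eq` (`G′ᴾ R_S = (1 − P₀) G R_S`) reads `R_S G′ᴾ = R_S G (1 − P₀)` (`R_S`, `G′ᴾ`, `P₀` symmetric: ✓`RS_isSymmetric`, P4a ✓`GprimeP_isSymmetric`, ✓`kerDProj_isSymmetric`);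
and P3v ✓`sub_projR_eq_G_lift_coeffSum` writes `(1 − projR)v = G(T c(v))` for a lifted coarse source, so `R_S(G g′) = projR(G g′) = G(g′ − T c(G g′))`: **`D R_S G′ᴾ g = D G f`,
`f := g′ − T c(G g′)`** — the gradient falls on `G` ALONE (no `D(1 − projR)`, no `hDcol`).  §2 bounds `‖f‖_∞ ≤ 5(1 + C_src·B_∞)‖g‖_∞` (P4b ✓`norm_equiv_sub_kerDProj_apply_le`: `‖g′‖_∞ ≤ 5‖g‖_∞`;
the VALUE letter; the source letter `‖T c(v)‖_∞ ≤ C_src‖v‖_∞`, P3v ✓`norm_equiv_complementary_source_apply_le`) and applies T1: `‖D R_S G′ᴾ g‖_∞ ≤ R₁·5(1 + C_src B_∞)·‖g‖_∞` = P4a's `hrow`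
with `R := 5R₁(1 + C_src B_∞)`; §3 is P4a: `Σ_x ‖toL2S⁻¹(G′ᴾ(R_S(D*(toL2(δ_bd ⊗ E)))))(x)‖ ≤ 4√2·R·‖E‖` = hPcol's display with `p139 := 20√2·R₁(1 + C_src B_∞)`.
WHAT IS PROVED (ns `Summit.QuantumFields.YangMills.Theorems.Prop7PcolOfGradientRow`; LOD letters `Q″ ι T hT a G hAG hGA`, Lift letters `hRS hker` DISPLAYED as in P1∕P3v; `G′ᴾ`'s parameter
`0 ≤ a′` — the EX face's `a L i` — is independent of the LOD mass `a > 0`, as in P1, so the Idx knit may pin `a := 1`).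
* §1 `inner_massiveOp_comm`, ★`isSymmetric_G` (`G_a` symmetric), ★★★`RS_GprimeP_eq` (`R_S(G′ᴾ g) = R_S(G(g − P₀ g))`, the adjoint of P1), ★`RS_G_eq_of_sourceForm`
  (`R_S(G v) = G(v − T(c(G v)))` for ANY source map `c` with `∀ v, v − projR v = G(T(c v))`), ★★`DL2_RS_GprimeP_eq_of_sourceForm` (`D R_S G′ᴾ g = D G(g′ − T c(G g′))`).
* §2 `norm_equiv_source_le` (the `‖f‖_∞` bookkeeping); ★★★`gradient_row_of_letters` — P4a's `hrow` for `D_{U₀} R_S G′ᴾ` with `R := R₁·(5·(1 + C_src·B_∞))` from the three DISPLAYED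
  sup→sup letters `hT1` (GRAD of `G`), `hGsup` (VALUE of `G`), `hsrc` (source of `1 − projR`) and an abstract source map `c`.
* §3 ★★★`hPcol_of_letters` — hPcol's display `Σ_x ‖toL2S⁻¹(G′ᴾ(R_S(D*_{U₀}(toL2(δ_bd ⊗ E)))))(x)‖ ≤ 4√2·(R₁·5(1 + C_src B_∞))·‖E‖` from the same letters (P4a ∘ §2).
* §4 ★★`hsrc_of_P3v` — the source letter `hsrc` DISCHARGED by P3v at its Gram-coefficient source map (P3v's window∕gap∕coercivity∕column letters verbatim), and ★★★`hPcol_of_T1_of_value` —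
  hPcol's display at one member CONDITIONAL ONLY on the two general-source letters `hT1` (T1: px19 g13 `…MassiveSolutionGradientSup` §1–§2 + px12 g16 `…MassiveSolutionGradientSupOfRegPr`)
  and `hGsup` (px12 g16, the general-source VALUE row), plus P3v's VALUE letters — the closed edition is one `exact` per letter once those land.
HYP-SAT (★★OWNER RULING №42): `hT` `hAG` `hGA` ⟸ ✓`exists_massive_inverse` with `T := (ι∘Q″)†`; `hRS` `hker` ⟸ ✓`RS_eq_projR_of_lift`∕✓`exists_intertwiner_of_regPr` under the row's own Lift
antecedent + `RegPr` + `10¹²L³ε₀ ≤ 1`; `hT1`∕`hGsup`∕`hsrc` are real-inequality schemas over ALL bounded site fields (inhabited with K-free constants by the files named; tested at `f = 0`,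
`F_b = 1` they only force `0 ≤ R₁, B_∞, C_src` — non-vacuous, no `Prop` placeholder); P3v's letters as in P3v (HYP-SAT there).  Conclusions are kernel bounds for the row's own objects.
HONEST SCOPE.  Linear algebra + bookkeeping over landed bricks; CONDITIONAL on `hT1` and `hGsup` (§2–§4); nothing of T1, the general-source VALUE row, the Idx-level discharge into `p139 L`,
the ten EX rows, `hT`, `hGF`, EX `stub_existenceMinimalOrbit` or the crux is proved here; the Yang–Mills mass gap is NOT proved.

References: T. Bałaban, CMP **99** (1985) 389–434 [Balaban1985BackgroundPropagators] ((3.11) p.392, (3.20)–(3.25) p.394, Thm 3.1 (3.42)∕(3.46) pp.397–398, (3.49) p.399, (3.118)–(3.122)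
pp.419–420); CMP **102** (1985) 277–309 [Balaban1985Variational] ((138)–(139) p.299 «`G′RD*` is a bounded operator in the norm |·|₍₁₎»).
-/

set_option autoImplicit false

noncomputable section

open scoped BigOperators Matrix.Norms.L2Operator InnerProductSpace ComplexConjugate Matrix

namespace Summit.QuantumFields.YangMills.Theorems.Prop7PcolOfGradientRow

open Literature.MathematicalPhysics.QuantumFieldTheory.Balaban1983to89
open Literature.MathematicalPhysics.QuantumFieldTheory.Balaban1983to89.T3ContinuumYM3Torus
open T4Continuum BlockAveraging
open BlockAveraging (Idx)
open B7Prop1Explicit (U1 disp)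
open B5Eq118OneStroke (iterBlockOf)
open B10Eq27TorusAxialLog (holT transl)
open B7TransferAnalyticMean (meanCLM)
open B4Sect5Torus (TSite)
open B9SectCLatticeCarrier (Bond)
open B9Eq311L2Pairing (WL2)
open B11Eq103H1Complex (SiteL2K BondL2K projR)
open Summit.QuantumFields.YangMills.Theorems.Prop8Chart (emlIterU)
open T3SectALandauChart (eta eta_pos bgUnits)
open T3PrintedRegularMinimiser (RegPr)
open T3PrintedRegularOrbits (sites_eq)
open T3LevelShift (siteShift)
open Summit.QuantumFields.YangMills.Theorems.Prop7SectET3Transport (periodsT3 siteEquiv bondEquiv)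
open Summit.QuantumFields.YangMills.Theorems.Prop7SectET3HilbertLetters (W₂ frobEquiv toL2 toL2S DL2 DstarL2 covLapSite)
open Summit.QuantumFields.YangMills.Theorems.Prop7SectET3GaugeProjector (NS RS RS_isSymmetric)
open Summit.QuantumFields.YangMills.Theorems.Prop7SectET3DeltaPiPInv (kerDProj GprimeP kerDProj_isSymmetric)
open Summit.QuantumFields.YangMills.Theorems.Prop7CovLapSiteEntryRows (isSymmetric_covLapSite)
open Summit.QuantumFields.YangMills.Theorems.Prop7SiteEntryCoordinates (orthonormal_spike top_le_span_spike)
open Summit.QuantumFields.YangMills.Theorems.Prop7PcolOperatorReduction (GprimeP_RS_eq)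
open Summit.QuantumFields.YangMills.Theorems.Prop7KernelColumnRowDuality (GprimeP_isSymmetric sum_norm_GprimeP_RS_DstarL2_single_le_of_gradient_row)
open Summit.QuantumFields.YangMills.Theorems.Prop7KerDProjSupBound (norm_equiv_sub_kerDProj_apply_le)
open Summit.QuantumFields.YangMills.Theorems.Prop7ComplementaryProjectorSourceForm (sub_projR_eq_G_lift_coeffSum norm_equiv_complementary_source_apply_le)

variable (F : T3Family) {n K : ℕ} (h : n ≤ K) {c₀ c₁ cB : ℝ} [Fact (0 < c₀)] [Fact (0 < c₁)] [Fact (0 < cB)]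
  {ε₀ : ℝ} (hε₀ : 0 < ε₀) (hε7 : 10 ^ 7 * (F.L : ℝ) ^ 3 * ε₀ ≤ 1)
  (U₀ : GaugeField (F.P K) 0 (Matrix.specialUnitaryGroup (Fin 2) ℂ)) (hreg : RegPr F n K ε₀ U₀)
  (Q'' : SiteL2K ℂ 3 (periodsT3 F K) c₀ W₂ →ₗ[ℂ] (Site (F.P K) (K - n) → Matrix (Fin 2) (Fin 2) ℂ))
  (hseq : ∀ lam : Site (F.P K) 0 → Matrix (Fin 2) (Fin 2) ℂ, ∃ ns : (j : ℕ) → Site (F.P K) j → Matrix (Fin 2) (Fin 2) ℂ, ns 0 = lam ∧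
      (∀ (j : ℕ) (y : Site (F.P K) (j + 1)), ns (j + 1) y = ns j (emb y) - meanCLM (Idx (F.P K)) (Matrix (Fin 2) (Fin 2) ℂ) fun i : Idx (F.P K) =>
        ns j (emb y) - ((holT (emlIterU j (bgUnits F K U₀)) (emb y) (stairWord i.2.1 (off i.1)) : (Matrix (Fin 2) (Fin 2) ℂ)ˣ) : Matrix (Fin 2) (Fin 2) ℂ) *
          ns j (transl (emb y) (disp (stairWord i.2.1 (off i.1)))) * (((holT (emlIterU j (bgUnits F K U₀)) (emb y) (stairWord i.2.1 (off i.1)))⁻¹ : (Matrix (Fin 2) (Fin 2) ℂ)ˣ) : Matrix (Fin 2) (Fin 2) ℂ)) ∧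
      ns (K - n) = Q'' (toL2S F K c₀ lam))
  (ι : (Site (F.P K) (K - n) → Matrix (Fin 2) (Fin 2) ℂ) →ₗ[ℂ] SiteL2K ℂ 3 (periodsT3 F n) c₁ W₂)
  (hι : ∀ c, ι c = toL2S F n c₁ (fun z => c (siteShift (sites_eq F n K h) z)))
  (T : SiteL2K ℂ 3 (periodsT3 F n) c₁ W₂ →ₗ[ℂ] SiteL2K ℂ 3 (periodsT3 F K) c₀ W₂)
  (hT : ∀ (l : SiteL2K ℂ 3 (periodsT3 F K) c₀ W₂) (f : SiteL2K ℂ 3 (periodsT3 F n) c₁ W₂), ⟪ι (Q'' l), f⟫_ℂ = ⟪l, T f⟫_ℂ)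
  {a : ℝ} (ha : 0 < a)
  (G : SiteL2K ℂ 3 (periodsT3 F K) c₀ W₂ →ₗ[ℂ] SiteL2K ℂ 3 (periodsT3 F K) c₀ W₂)
  (hAG : ∀ f, covLapSite F n K c₀ U₀ (G f) + (a : ℂ) • T (ι (Q'' (G f))) = f)
  (hGA : ∀ u, G (covLapSite F n K c₀ U₀ u + (a : ℂ) • T (ι (Q'' u))) = u)
  (hRS : RS F n K h c₀ cB U₀ = projR (covLapSite F n K c₀ U₀) Q'')
  (hker : LinearMap.ker Q'' ≤ NS F n K h c₀ cB U₀)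

/-! ## §1 The operator identity `R_S G′ᴾ = R_S G (1 − P₀)` and the source form of `R_S G` -/

include hT in
omit [Fact (0 < cB)] in
/-- The massive operator `Δ^η_{U₀} + a·TιQ″` is symmetric: `Δ^η` is (✓`isSymmetric_covLapSite`) and `TιQ″ = (ιQ″)†(ιQ″)` by `hT`; `a` is real.
[cite: Balaban1985BackgroundPropagators, (3.23)–(3.25) p.394] -/
theorem inner_massiveOp_comm (u v : SiteL2K ℂ 3 (periodsT3 F K) c₀ W₂) :
    ⟪covLapSite F n K c₀ U₀ u + (a : ℂ) • T (ι (Q'' u)), v⟫_ℂ = ⟪u, covLapSite F n K c₀ U₀ v + (a : ℂ) • T (ι (Q'' v))⟫_ℂ := by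
  have hΔ : ⟪covLapSite F n K c₀ U₀ u, v⟫_ℂ = ⟪u, covLapSite F n K c₀ U₀ v⟫_ℂ := isSymmetric_covLapSite F U₀ u v
  have h1 : ⟪T (ι (Q'' u)), v⟫_ℂ = ⟪u, T (ι (Q'' v))⟫_ℂ := by
    calc ⟪T (ι (Q'' u)), v⟫_ℂ = (starRingEnd ℂ) ⟪v, T (ι (Q'' u))⟫_ℂ := (inner_conj_symm _ _).symm
      _ = (starRingEnd ℂ) ⟪ι (Q'' v), ι (Q'' u)⟫_ℂ := by rw [hT v (ι (Q'' u))]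
      _ = ⟪ι (Q'' u), ι (Q'' v)⟫_ℂ := inner_conj_symm _ _
      _ = ⟪u, T (ι (Q'' v))⟫_ℂ := hT u (ι (Q'' v))
  rw [inner_add_left, inner_add_right, inner_smul_left, inner_smul_right, Complex.conj_ofReal, hΔ, h1]

include hT hAG in
omit [Fact (0 < cB)] in
/-- ★ **THE LOD PROPAGATOR `G_a` IS SYMMETRIC** (`⟪Gx, y⟫ = ⟪Gx, A(Gy)⟫ = ⟪A(Gx), Gy⟫ = ⟪x, Gy⟫`, `A = Δ^η + a·TιQ″` symmetric, `A ∘ G = 1`).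
[cite: Balaban1985BackgroundPropagators, (3.24)–(3.25) p.394] -/
theorem isSymmetric_G : G.IsSymmetric := by
  intro x y
  calc ⟪G x, y⟫_ℂ = ⟪G x, covLapSite F n K c₀ U₀ (G y) + (a : ℂ) • T (ι (Q'' (G y)))⟫_ℂ := by rw [hAG y]
    _ = ⟪covLapSite F n K c₀ U₀ (G x) + (a : ℂ) • T (ι (Q'' (G x))), G y⟫_ℂ := (inner_massiveOp_comm F U₀ Q'' ι T hT (G x) (G y)).symm
    _ = ⟪x, G y⟫_ℂ := by rw [hAG x]

include hT hAG hGA hRS hker in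
/-- ★★★ **`R_S(G′ᴾ_{a′} g) = R_S(G_a(g − P₀ g))` FOR EVERY SITE FIELD `g` AND EVERY `0 ≤ a′`** (`G′ᴾ`'s parameter `a′` — the EX face's `a L i` — is INDEPENDENT of the LOD mass
`a > 0` of `G`, exactly as in P1) — the ADJOINT of P1 ✓`GprimeP_RS_eq` (`G′ᴾ(R_S w) = G(R_S w) − P₀(G(R_S w))`): test against `w`,
move `R_S`, `G′ᴾ`, `G`, `P₀` across the scalar product (all symmetric), and read back. [cite: Balaban1985BackgroundPropagators, (3.21)–(3.25) p.394, (3.118)–(3.122) pp.419–420] -/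
theorem RS_GprimeP_eq {a' : ℝ} (ha' : 0 ≤ a') (g : SiteL2K ℂ 3 (periodsT3 F K) c₀ W₂) :
    RS F n K h c₀ cB U₀ (GprimeP F n K h c₀ cB a' U₀ g) = RS F n K h c₀ cB U₀ (G (g - kerDProj F n K c₀ U₀ g)) := by
  have hRSs : (RS F n K h c₀ cB U₀).IsSymmetric := RS_isSymmetric U₀
  have hGPs : (GprimeP F n K h c₀ cB a' U₀).IsSymmetric := GprimeP_isSymmetric F c₀ h cB a' ha' U₀
  have hP0s : (kerDProj F n K c₀ U₀).IsSymmetric := kerDProj_isSymmetric U₀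
  have hGs : G.IsSymmetric := isSymmetric_G F U₀ Q'' ι T hT G hAG
  refine ext_inner_right ℂ fun w => ?_
  have hP1 := GprimeP_RS_eq F h U₀ Q'' ι T G hGA hRS hker ha' w
  calc ⟪RS F n K h c₀ cB U₀ (GprimeP F n K h c₀ cB a' U₀ g), w⟫_ℂ
      = ⟪GprimeP F n K h c₀ cB a' U₀ g, RS F n K h c₀ cB U₀ w⟫_ℂ := hRSs _ _
    _ = ⟪g, GprimeP F n K h c₀ cB a' U₀ (RS F n K h c₀ cB U₀ w)⟫_ℂ := hGPs _ _
    _ = ⟪g, G (RS F n K h c₀ cB U₀ w) - kerDProj F n K c₀ U₀ (G (RS F n K h c₀ cB U₀ w))⟫_ℂ := by rw [hP1]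
    _ = ⟪g, G (RS F n K h c₀ cB U₀ w)⟫_ℂ - ⟪g, kerDProj F n K c₀ U₀ (G (RS F n K h c₀ cB U₀ w))⟫_ℂ := inner_sub_right _ _ _
    _ = ⟪G g, RS F n K h c₀ cB U₀ w⟫_ℂ - ⟪G (kerDProj F n K c₀ U₀ g), RS F n K h c₀ cB U₀ w⟫_ℂ := by
        rw [← hGs g, ← hP0s g, ← hGs (kerDProj F n K c₀ U₀ g)]
    _ = ⟪G g - G (kerDProj F n K c₀ U₀ g), RS F n K h c₀ cB U₀ w⟫_ℂ := (inner_sub_left _ _ _).symm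
    _ = ⟪RS F n K h c₀ cB U₀ (G (g - kerDProj F n K c₀ U₀ g)), w⟫_ℂ := by rw [← map_sub, hRSs]

include hRS in
omit [Fact (0 < c₁)] [Fact (0 < cB)] in
/-- ★ **THE SOURCE FORM OF `R_S G`**: if `(1 − projR)v = G(T(c v))` for every `v` (ANY source map `c` — P3v ✓`sub_projR_eq_G_lift_coeffSum` gives the Gram-coefficient one), then under Lift
`R_S(G v) = projR(G v) = G v − G(T(c(G v))) = G(v − T(c(G v)))`. [cite: Balaban1985BackgroundPropagators, (3.21)–(3.25) p.394, (3.49) p.399] -/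
theorem RS_G_eq_of_sourceForm (c : SiteL2K ℂ 3 (periodsT3 F K) c₀ W₂ → SiteL2K ℂ 3 (periodsT3 F n) c₁ W₂)
    (hsrcid : ∀ v, v - projR (covLapSite F n K c₀ U₀) Q'' v = G (T (c v))) (v : SiteL2K ℂ 3 (periodsT3 F K) c₀ W₂) :
    RS F n K h c₀ cB U₀ (G v) = G (v - T (c (G v))) := by
  rw [hRS, map_sub, ← hsrcid (G v), sub_sub_cancel]

include hT hAG hGA hRS hker in
/-- ★★ **`D_{U₀} R_S G′ᴾ g = D_{U₀} G (g′ − T(c(G g′)))`, `g′ := g − P₀ g`** — the gradient falls on `G` ALONE.  (§1's two identities composed; no `D(1 − projR)`, no `hDcol`.)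
[cite: Balaban1985Variational, (138)–(139) p.299; Balaban1985BackgroundPropagators, (3.25) p.394] -/
theorem DL2_RS_GprimeP_eq_of_sourceForm {a' : ℝ} (ha' : 0 ≤ a') (c : SiteL2K ℂ 3 (periodsT3 F K) c₀ W₂ → SiteL2K ℂ 3 (periodsT3 F n) c₁ W₂)
    (hsrcid : ∀ v, v - projR (covLapSite F n K c₀ U₀) Q'' v = G (T (c v))) (g : SiteL2K ℂ 3 (periodsT3 F K) c₀ W₂) :
    DL2 F n K c₀ U₀ (RS F n K h c₀ cB U₀ (GprimeP F n K h c₀ cB a' U₀ g))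
      = DL2 F n K c₀ U₀ (G ((g - kerDProj F n K c₀ U₀ g) - T (c (G (g - kerDProj F n K c₀ U₀ g))))) := by
  have h1 := RS_GprimeP_eq F h U₀ Q'' ι T hT G hAG hGA hRS hker ha' g
  have h2 := RS_G_eq_of_sourceForm F h U₀ Q'' T G hRS c hsrcid (g - kerDProj F n K c₀ U₀ g)
  rw [h1, h2]

/-! ## §2 P4a's gradient row letter from three sup→sup letters -/

omit [Fact (0 < c₁)] [Fact (0 < cB)] in
/-- The `‖f‖_∞` bookkeeping: `‖(g′ − T(c(G g′)))(y)‖ ≤ 5Gb + C_src·(B_∞·(5Gb))`, `g′ = g − P₀ g` (P4b ✓`norm_equiv_sub_kerDProj_apply_le`, the VALUE letter, the source letter).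
[cite: Balaban1985BackgroundPropagators, (3.24)–(3.25) p.394, Thm 3.1 (3.42) p.397] -/
theorem norm_equiv_source_le (c : SiteL2K ℂ 3 (periodsT3 F K) c₀ W₂ → SiteL2K ℂ 3 (periodsT3 F n) c₁ W₂)
    {Csrc : ℝ} (hsrc : ∀ (v : SiteL2K ℂ 3 (periodsT3 F K) c₀ W₂) (Vb : ℝ), (∀ y, ‖WL2.equiv ℂ _ W₂ v y‖ ≤ Vb) → ∀ y, ‖WL2.equiv ℂ _ W₂ (T (c v)) y‖ ≤ Csrc * Vb)
    {Bv : ℝ} (hGsup : ∀ (f : SiteL2K ℂ 3 (periodsT3 F K) c₀ W₂) (Fb : ℝ), (∀ y, ‖WL2.equiv ℂ _ W₂ f y‖ ≤ Fb) → ∀ y, ‖WL2.equiv ℂ _ W₂ (G f) y‖ ≤ Bv * Fb)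
    (g : SiteL2K ℂ 3 (periodsT3 F K) c₀ W₂) {Gb : ℝ} (hg : ∀ y, ‖WL2.equiv ℂ _ W₂ g y‖ ≤ Gb) (y : TSite 3 (periodsT3 F K)) :
    ‖WL2.equiv ℂ _ W₂ ((g - kerDProj F n K c₀ U₀ g) - T (c (G (g - kerDProj F n K c₀ U₀ g)))) y‖ ≤ 5 * Gb + Csrc * (Bv * (5 * Gb)) := by
  have hg' : ∀ y, ‖WL2.equiv ℂ _ W₂ (g - kerDProj F n K c₀ U₀ g) y‖ ≤ 5 * Gb := fun y => norm_equiv_sub_kerDProj_apply_le F (n := n) c₀ U₀ g hg y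
  have hGg' := hGsup _ _ hg'
  have hTc := hsrc _ _ hGg'
  rw [WL2.equiv_sub, Pi.sub_apply]
  exact (norm_sub_le _ _).trans (add_le_add (hg' y) (hTc y))

include hT hAG hGA hRS hker in
/-- ★★★ **P4a's `hrow` FOR `D_{U₀} R_S G′ᴾ` FROM THE LETTERS**: with `(1 − projR)v = G(T(c v))` and the sup→sup letters `hsrc` (`‖T(c v)‖_∞ ≤ C_src‖v‖_∞`), `hGsup` (`‖G f‖_∞ ≤ B_∞‖f‖_∞`),
`hT1` (`‖D_{U₀}G f‖_∞ ≤ R₁‖f‖_∞`, pointwise on bonds): `‖(D_{U₀}(R_S(G′ᴾ g)))(p)‖ ≤ R₁·(5·(1 + C_src·B_∞))·Gb` whenever `‖g(y)‖ ≤ Gb` for all `y`.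
[cite: Balaban1985Variational, (138)–(139) p.299; Balaban1985BackgroundPropagators, Thm 3.1 (3.42) p.397] -/
theorem gradient_row_of_letters {a' : ℝ} (ha' : 0 ≤ a') (c : SiteL2K ℂ 3 (periodsT3 F K) c₀ W₂ → SiteL2K ℂ 3 (periodsT3 F n) c₁ W₂)
    (hsrcid : ∀ v, v - projR (covLapSite F n K c₀ U₀) Q'' v = G (T (c v)))
    {Csrc : ℝ} (hsrc : ∀ (v : SiteL2K ℂ 3 (periodsT3 F K) c₀ W₂) (Vb : ℝ), (∀ y, ‖WL2.equiv ℂ _ W₂ v y‖ ≤ Vb) → ∀ y, ‖WL2.equiv ℂ _ W₂ (T (c v)) y‖ ≤ Csrc * Vb)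
    {Bv : ℝ} (hGsup : ∀ (f : SiteL2K ℂ 3 (periodsT3 F K) c₀ W₂) (Fb : ℝ), (∀ y, ‖WL2.equiv ℂ _ W₂ f y‖ ≤ Fb) → ∀ y, ‖WL2.equiv ℂ _ W₂ (G f) y‖ ≤ Bv * Fb)
    {R₁ : ℝ} (hT1 : ∀ (f : SiteL2K ℂ 3 (periodsT3 F K) c₀ W₂) (Fb : ℝ), (∀ y, ‖WL2.equiv ℂ _ W₂ f y‖ ≤ Fb) →
      ∀ p : Bond 3 (periodsT3 F K), ‖WL2.equiv ℂ _ W₂ (DL2 F n K c₀ U₀ (G f)) p‖ ≤ R₁ * Fb)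
    (g : SiteL2K ℂ 3 (periodsT3 F K) c₀ W₂) (Gb : ℝ) (hg : ∀ y, ‖WL2.equiv ℂ _ W₂ g y‖ ≤ Gb) (p : Bond 3 (periodsT3 F K)) :
    ‖WL2.equiv ℂ _ W₂ (DL2 F n K c₀ U₀ (RS F n K h c₀ cB U₀ (GprimeP F n K h c₀ cB a' U₀ g))) p‖ ≤ R₁ * (5 * (1 + Csrc * Bv)) * Gb := by
  have hf := norm_equiv_source_le F U₀ T G c hsrc hGsup g hg
  have h1 := hT1 _ _ hf p
  rw [DL2_RS_GprimeP_eq_of_sourceForm F h U₀ Q'' ι T hT G hAG hGA hRS hker ha' c hsrcid g]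
  calc ‖WL2.equiv ℂ _ W₂ (DL2 F n K c₀ U₀ (G ((g - kerDProj F n K c₀ U₀ g) - T (c (G (g - kerDProj F n K c₀ U₀ g)))))) p‖
      ≤ R₁ * (5 * Gb + Csrc * (Bv * (5 * Gb))) := h1
    _ = R₁ * (5 * (1 + Csrc * Bv)) * Gb := by ring

/-! ## §3 hPcol's display from the letters -/

include hT hAG hGA hRS hker in
/-- ★★★ **hPcol's DISPLAY FROM THE LETTERS**: `Σ_{x : Site (F.P K) 0} ‖toL2S⁻¹(G′ᴾ(R_S(D*_{U₀}(toL2(δ_bd ⊗ E)))))(x)‖ ≤ 4·√2·(R₁·(5·(1 + C_src·B_∞)))·‖E‖` — P4a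
✓`sum_norm_GprimeP_RS_DstarL2_single_le_of_gradient_row` ∘ §2.  This is the EX row `hPcol` (✓`minimiserStabilityRegPr_of_EXrowsS44LG` :243–252) at one member with
`p139 := 20√2·R₁·(1 + C_src·B_∞)`, modulo the three sup→sup letters. [cite: Balaban1985Variational, (139) p.299; Balaban1985BackgroundPropagators, Thm 3.1 (3.42) p.397, (3.11) p.392] -/
theorem hPcol_of_letters {a' : ℝ} (ha' : 0 ≤ a') (c : SiteL2K ℂ 3 (periodsT3 F K) c₀ W₂ → SiteL2K ℂ 3 (periodsT3 F n) c₁ W₂)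
    (hsrcid : ∀ v, v - projR (covLapSite F n K c₀ U₀) Q'' v = G (T (c v)))
    {Csrc : ℝ} (hsrc : ∀ (v : SiteL2K ℂ 3 (periodsT3 F K) c₀ W₂) (Vb : ℝ), (∀ y, ‖WL2.equiv ℂ _ W₂ v y‖ ≤ Vb) → ∀ y, ‖WL2.equiv ℂ _ W₂ (T (c v)) y‖ ≤ Csrc * Vb)
    {Bv : ℝ} (hGsup : ∀ (f : SiteL2K ℂ 3 (periodsT3 F K) c₀ W₂) (Fb : ℝ), (∀ y, ‖WL2.equiv ℂ _ W₂ f y‖ ≤ Fb) → ∀ y, ‖WL2.equiv ℂ _ W₂ (G f) y‖ ≤ Bv * Fb)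
    {R₁ : ℝ} (hT1 : ∀ (f : SiteL2K ℂ 3 (periodsT3 F K) c₀ W₂) (Fb : ℝ), (∀ y, ‖WL2.equiv ℂ _ W₂ f y‖ ≤ Fb) →
      ∀ p : Bond 3 (periodsT3 F K), ‖WL2.equiv ℂ _ W₂ (DL2 F n K c₀ U₀ (G f)) p‖ ≤ R₁ * Fb)
    (bd : PBond (F.P K) 0) (E : Matrix (Fin 2) (Fin 2) ℂ) :
    ∑ x : Site (F.P K) 0, ‖(toL2S F K c₀).symm (GprimeP F n K h c₀ cB a' U₀ (RS F n K h c₀ cB U₀ (DstarL2 F n K c₀ U₀ (toL2 F K c₀ (Pi.single bd E))))) x‖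
      ≤ 4 * Real.sqrt 2 * (R₁ * (5 * (1 + Csrc * Bv))) * ‖E‖ :=
  sum_norm_GprimeP_RS_DstarL2_single_le_of_gradient_row F c₀ h cB a' ha' U₀
    (fun g Gb hg p => gradient_row_of_letters F h U₀ Q'' ι T hT G hAG hGA hRS hker ha' c hsrcid hsrc hGsup hT1 g Gb hg p) bd E

/-! ## §4 The source letter discharged by P3v; hPcol modulo T1 and the general-source VALUE letter -/

include hε₀ hε7 hreg hseq hι hT ha hAG in
/-- ★★ **THE SOURCE LETTER `hsrc` FROM P3v** at the Gram-coefficient source map `c(v) = Σ_i λ_i(v)•b i`: `‖(T c(v))(y)‖ ≤ C_src·Vb` for ALL lit-sites `y` whenever `‖v(y)‖ ≤ Vb` for all `y`,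
`C_src = 4·A_T·(C_N·4(2(1+1∕μ′))³·c₀(√c₁)⁻¹C_pt ℓ³(2(1+1∕κ))³)` (P3v ✓`norm_equiv_complementary_source_apply_le`, read through `siteEquiv`).
[cite: Balaban1985BackgroundPropagators, Thm 3.1 (3.42)∕(3.46) pp.397–398, (3.49) p.399] -/
theorem hsrc_of_P3v
    {μ' : ℝ} (hμ' : 0 < μ')
    {δ₁ : ℝ} (hδ₁ : 0 ≤ δ₁)
    (hδ : 3 * ((eta F n K)⁻¹) ^ 2 * (Real.exp (μ' * eta F n K) - 1) ^ 2 + a * ((25 / 8) * (c₁ * ((((F.P K).L : ℝ) ^ (F.P K).d) ^ (K - n))⁻¹ / c₀)) * (Real.exp (3 * μ') - 1) ^ 2 ≤ δ₁ ^ 2)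
    (hwin : Real.sqrt (max 2 (16 * c₀ * ((F.L : ℝ) ^ (K - n)) ^ 3 / (a * c₁))) * δ₁ ≤ 1 / 10)
    {CT : ℝ} (hCT : 0 ≤ CT) (hCTb : ∀ l : SiteL2K ℂ 3 (periodsT3 F K) c₀ W₂, ‖ι (Q'' l)‖ ≤ CT * ‖l‖)
    {CG : ℝ} (hCG : 0 ≤ CG) (hGn : ∀ f, ‖G f‖ ≤ CG * ‖f‖)
    {mB : ℝ} (hmB : 0 < mB) (hcoer : ∀ f : SiteL2K ℂ 3 (periodsT3 F n) c₁ W₂, mB * ‖f‖ ≤ ‖G (T f)‖)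
    (hgap : 3 * ((Real.sqrt (max 2 (16 * c₀ * ((F.L : ℝ) ^ (K - n)) ^ 3 / (a * c₁))) * (2 + Real.sqrt (max 2 (16 * c₀ * ((F.L : ℝ) ^ (K - n)) ^ 3 / (a * c₁)))))
          * (Real.sqrt 3 * (eta F n K)⁻¹ * (Real.exp (μ' * eta F n K) - 1) + (Real.sqrt 3 * (eta F n K)⁻¹ * (Real.exp (μ' * eta F n K) - 1)) ^ 2 + Real.sqrt a * CT * (Real.exp (3 * μ') - 1) + a * CT ^ 2 * (Real.exp (3 * μ') - 1) ^ 2)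
          * (8 * Real.sqrt (max 2 (16 * c₀ * ((F.L : ℝ) ^ (K - n)) ^ 3 / (a * c₁))) + 8 * Real.sqrt (max 2 (16 * c₀ * ((F.L : ℝ) ^ (K - n)) ^ 3 / (a * c₁))) ^ 2)
          * (CT * (1 + (Real.exp (3 * μ') - 1))) + CG * (CT * (Real.exp (3 * μ') - 1))) ^ 2 < mB ^ 2 / 2)
    {Cpt κ : ℝ} (hCpt : 0 ≤ Cpt) (hκ : 0 < κ)
    (hcol : ∀ (y : Site (F.P K) (K - n)) (Y : Matrix (Fin 2) (Fin 2) ℂ) (x : Site (F.P K) 0),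
      ‖WL2.equiv ℂ _ W₂ (G (T (ι (Pi.single y Y)))) (siteEquiv F K x)‖ ≤ Cpt * Real.exp (-(κ * (Site.tdist (P := F.P K) (iterBlockOf (K - n) x) y : ℝ))) * ‖Y‖)
    (v : SiteL2K ℂ 3 (periodsT3 F K) c₀ W₂) (Vb : ℝ) (hv : ∀ y, ‖WL2.equiv ℂ _ W₂ v y‖ ≤ Vb) (y : TSite 3 (periodsT3 F K)) :
    ‖WL2.equiv ℂ _ W₂ (T ((fun v => ∑ i, (∑ i', (Matrix.of fun i i' : Site (F.P n) 0 × (Fin 2 × Fin 2) => ⟪G (T ((OrthonormalBasis.mk (orthonormal_spike F) (top_le_span_spike F) : OrthonormalBasis (Site (F.P n) 0 × (Fin 2 × Fin 2)) ℂ (SiteL2K ℂ 3 (periodsT3 F n) c₁ W₂)) i)), G (T ((OrthonormalBasis.mk (orthonormal_spike F) (top_le_span_spike F) : OrthonormalBasis (Site (F.P n) 0 × (Fin 2 × Fin 2)) ℂ (SiteL2K ℂ 3 (periodsT3 F n) c₁ W₂)) i'))⟫_ℂ)⁻¹ i i' * ⟪G (T ((OrthonormalBasis.mk (orthonormal_spike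 F) (top_le_span_spike F) : OrthonormalBasis (Site (F.P n) 0 × (Fin 2 × Fin 2)) ℂ (SiteL2K ℂ 3 (periodsT3 F n) c₁ W₂)) i')), v⟫_ℂ) • (OrthonormalBasis.mk (orthonormal_spike F) (top_le_span_spike F) : OrthonormalBasis (Site (F.P n) 0 × (Fin 2 × Fin 2)) ℂ (SiteL2K ℂ 3 (periodsT3 F n) c₁ W₂)) i) v)) y‖
      ≤ (4 * ((5 / 4) * Real.sqrt (2 * c₁) * ((((F.P K).L : ℝ) ^ (F.P K).d) ^ (K - n))⁻¹ / c₀ * (Real.sqrt (2 * c₁) * (Real.sqrt c₁)⁻¹)) * (((mB ^ 2 / 2 - 3 * ((Real.sqrt (max 2 (16 * c₀ * ((F.L : ℝ) ^ (K - n)) ^ 3 / (a * c₁))) * (2 + Real.sqrt (max 2 (16 * c₀ * ((F.L : ℝ) ^ (K - n)) ^ 3 / (a * c₁)))))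
          * (Real.sqrt 3 * (eta F n K)⁻¹ * (Real.exp (μ' * eta F n K) - 1) + (Real.sqrt 3 * (eta F n K)⁻¹ * (Real.exp (μ' * eta F n K) - 1)) ^ 2 + Real.sqrt a * CT * (Real.exp (3 * μ') - 1) + a * CT ^ 2 * (Real.exp (3 * μ') - 1) ^ 2)
          * (8 * Real.sqrt (max 2 (16 * c₀ * ((F.L : ℝ) ^ (K - n)) ^ 3 / (a * c₁))) + 8 * Real.sqrt (max 2 (16 * c₀ * ((F.L : ℝ) ^ (K - n)) ^ 3 / (a * c₁))) ^ 2)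
          * (CT * (1 + (Real.exp (3 * μ') - 1))) + CG * (CT * (Real.exp (3 * μ') - 1))) ^ 2)⁻¹ * Real.exp (9 * μ')) * (4 * (2 * (1 + 1 / μ')) ^ 3) * (c₀ * (Real.sqrt c₁)⁻¹ * Cpt * (((((F.P K).L : ℝ) ^ (F.P K).d) ^ (K - n)) * (2 * (1 + 1 / κ)) ^ 3)))) * Vb := by
  have hv' : ∀ x : Site (F.P K) 0, ‖WL2.equiv ℂ _ W₂ v (siteEquiv F K x)‖ ≤ Vb := fun x => hv _
  have h5 := norm_equiv_complementary_source_apply_le F h hε₀ hε7 U₀ hreg Q'' hseq ι hι T hT ha G hAG hμ' hδ₁ hδ hwin hCT hCTb hCG hGn hmB hcoer hgap hCpt hκ hcol v hv' ((siteEquiv F K).symm y)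
  rw [Equiv.apply_symm_apply] at h5
  refine h5.trans (le_of_eq ?_)
  ring

include hε₀ hε7 hreg hseq hι hT ha hAG hGA hRS hker in
/-- ★★★ **hPcol AT ONE MEMBER, MODULO T1 AND THE GENERAL-SOURCE VALUE LETTER.**  For a printed-regular member under the Lift letters `hRS hker`, LOD letters `Q″ hseq ι hι T hT a G hAG hGA`,
P3v's VALUE letters (Gram slope `μ′`, window `hδ hwin`, `hCTb hGn hcoer hgap`, column decay `hcol` ⟸ V4), and the two general-source sup→sup letters of the LOD propagator —
`hGsup : ‖(G f)(y)‖ ≤ B_∞·F_b` (VALUE) and `hT1 : ‖(D_{U₀}G f)(p)‖ ≤ R₁·F_b` (GRAD, T1) whenever `‖f(y)‖ ≤ F_b` for all `y` —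
`Σ_{x : Site (F.P K) 0} ‖toL2S⁻¹(G′ᴾ(R_S(D*_{U₀}(toL2(δ_bd ⊗ E)))))(x)‖ ≤ 4√2·(R₁·(5·(1 + C_src·B_∞)))·‖E‖`, `C_src` P3v's K-free source constant: THE DISPLAY OF THE EX ROW `hPcol` with
`p139 := 20√2·R₁(1 + C_src B_∞)`. [cite: Balaban1985Variational, (138)–(139) p.299; Balaban1985BackgroundPropagators, Thm 3.1 (3.42)∕(3.46) pp.397–398, (3.49) p.399, (3.21)–(3.25) p.394] -/
theorem hPcol_of_T1_of_value {a' : ℝ} (ha' : 0 ≤ a')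
    {μ' : ℝ} (hμ' : 0 < μ')
    {δ₁ : ℝ} (hδ₁ : 0 ≤ δ₁)
    (hδ : 3 * ((eta F n K)⁻¹) ^ 2 * (Real.exp (μ' * eta F n K) - 1) ^ 2 + a * ((25 / 8) * (c₁ * ((((F.P K).L : ℝ) ^ (F.P K).d) ^ (K - n))⁻¹ / c₀)) * (Real.exp (3 * μ') - 1) ^ 2 ≤ δ₁ ^ 2)
    (hwin : Real.sqrt (max 2 (16 * c₀ * ((F.L : ℝ) ^ (K - n)) ^ 3 / (a * c₁))) * δ₁ ≤ 1 / 10)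
    {CT : ℝ} (hCT : 0 ≤ CT) (hCTb : ∀ l : SiteL2K ℂ 3 (periodsT3 F K) c₀ W₂, ‖ι (Q'' l)‖ ≤ CT * ‖l‖)
    {CG : ℝ} (hCG : 0 ≤ CG) (hGn : ∀ f, ‖G f‖ ≤ CG * ‖f‖)
    {mB : ℝ} (hmB : 0 < mB) (hcoer : ∀ f : SiteL2K ℂ 3 (periodsT3 F n) c₁ W₂, mB * ‖f‖ ≤ ‖G (T f)‖)
    (hgap : 3 * ((Real.sqrt (max 2 (16 * c₀ * ((F.L : ℝ) ^ (K - n)) ^ 3 / (a * c₁))) * (2 + Real.sqrt (max 2 (16 * c₀ * ((F.L : ℝ) ^ (K - n)) ^ 3 / (a * c₁)))))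
          * (Real.sqrt 3 * (eta F n K)⁻¹ * (Real.exp (μ' * eta F n K) - 1) + (Real.sqrt 3 * (eta F n K)⁻¹ * (Real.exp (μ' * eta F n K) - 1)) ^ 2 + Real.sqrt a * CT * (Real.exp (3 * μ') - 1) + a * CT ^ 2 * (Real.exp (3 * μ') - 1) ^ 2)
          * (8 * Real.sqrt (max 2 (16 * c₀ * ((F.L : ℝ) ^ (K - n)) ^ 3 / (a * c₁))) + 8 * Real.sqrt (max 2 (16 * c₀ * ((F.L : ℝ) ^ (K - n)) ^ 3 / (a * c₁))) ^ 2)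
          * (CT * (1 + (Real.exp (3 * μ') - 1))) + CG * (CT * (Real.exp (3 * μ') - 1))) ^ 2 < mB ^ 2 / 2)
    {Cpt κ : ℝ} (hCpt : 0 ≤ Cpt) (hκ : 0 < κ)
    (hcol : ∀ (y : Site (F.P K) (K - n)) (Y : Matrix (Fin 2) (Fin 2) ℂ) (x : Site (F.P K) 0),
      ‖WL2.equiv ℂ _ W₂ (G (T (ι (Pi.single y Y)))) (siteEquiv F K x)‖ ≤ Cpt * Real.exp (-(κ * (Site.tdist (P := F.P K) (iterBlockOf (K - n) x) y : ℝ))) * ‖Y‖)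
    {Bv : ℝ} (hGsup : ∀ (f : SiteL2K ℂ 3 (periodsT3 F K) c₀ W₂) (Fb : ℝ), (∀ y, ‖WL2.equiv ℂ _ W₂ f y‖ ≤ Fb) → ∀ y, ‖WL2.equiv ℂ _ W₂ (G f) y‖ ≤ Bv * Fb)
    {R₁ : ℝ} (hT1 : ∀ (f : SiteL2K ℂ 3 (periodsT3 F K) c₀ W₂) (Fb : ℝ), (∀ y, ‖WL2.equiv ℂ _ W₂ f y‖ ≤ Fb) →
      ∀ p : Bond 3 (periodsT3 F K), ‖WL2.equiv ℂ _ W₂ (DL2 F n K c₀ U₀ (G f)) p‖ ≤ R₁ * Fb)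
    (bd : PBond (F.P K) 0) (E : Matrix (Fin 2) (Fin 2) ℂ) :
    ∑ x : Site (F.P K) 0, ‖(toL2S F K c₀).symm (GprimeP F n K h c₀ cB a' U₀ (RS F n K h c₀ cB U₀ (DstarL2 F n K c₀ U₀ (toL2 F K c₀ (Pi.single bd E))))) x‖
      ≤ 4 * Real.sqrt 2 * (R₁ * (5 * (1 + (4 * ((5 / 4) * Real.sqrt (2 * c₁) * ((((F.P K).L : ℝ) ^ (F.P K).d) ^ (K - n))⁻¹ / c₀ * (Real.sqrt (2 * c₁) * (Real.sqrt c₁)⁻¹)) * (((mB ^ 2 / 2 - 3 * ((Real.sqrt (max 2 (16 * c₀ * ((F.L : ℝ) ^ (K - n)) ^ 3 / (a * c₁))) * (2 + Real.sqrt (max 2 (16 * c₀ * ((F.L : ℝ) ^ (K - n)) ^ 3 / (a * c₁)))))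
          * (Real.sqrt 3 * (eta F n K)⁻¹ * (Real.exp (μ' * eta F n K) - 1) + (Real.sqrt 3 * (eta F n K)⁻¹ * (Real.exp (μ' * eta F n K) - 1)) ^ 2 + Real.sqrt a * CT * (Real.exp (3 * μ') - 1) + a * CT ^ 2 * (Real.exp (3 * μ') - 1) ^ 2)
          * (8 * Real.sqrt (max 2 (16 * c₀ * ((F.L : ℝ) ^ (K - n)) ^ 3 / (a * c₁))) + 8 * Real.sqrt (max 2 (16 * c₀ * ((F.L : ℝ) ^ (K - n)) ^ 3 / (a * c₁))) ^ 2)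
          * (CT * (1 + (Real.exp (3 * μ') - 1))) + CG * (CT * (Real.exp (3 * μ') - 1))) ^ 2)⁻¹ * Real.exp (9 * μ')) * (4 * (2 * (1 + 1 / μ')) ^ 3) * (c₀ * (Real.sqrt c₁)⁻¹ * Cpt * (((((F.P K).L : ℝ) ^ (F.P K).d) ^ (K - n)) * (2 * (1 + 1 / κ)) ^ 3)))) * Bv))) * ‖E‖ :=
  hPcol_of_letters F h U₀ Q'' ι T hT G hAG hGA hRS hker ha' (fun v => ∑ i, (∑ i', (Matrix.of fun i i' : Site (F.P n) 0 × (Fin 2 × Fin 2) => ⟪G (T ((OrthonormalBasis.mk (orthonormal_spike F) (top_le_span_spike F) : OrthonormalBasis (Site (F.P n) 0 × (Fin 2 × Fin 2)) ℂ (SiteL2K ℂ 3 (periodsT3 F n) c₁ W₂)) i)), G (T ((OrthonormalBasis.mk (orthonormal_spike F) (top_le_span_spike F) : OrthonormalBasis (Site (F.P n) 0 × (Fin 2 × Fin 2)) ℂ (SiteL2K ℂ 3 (periodsT3 F n) c₁ W₂)) i'))⟫_ℂ)⁻¹ i i' * ⟪G (T ((OrthonormalBasis.mk (orthonormal_spike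 F) (top_le_span_spike F) : OrthonormalBasis (Site (F.P n) 0 × (Fin 2 × Fin 2)) ℂ (SiteL2K ℂ 3 (periodsT3 F n) c₁ W₂)) i')), v⟫_ℂ) • (OrthonormalBasis.mk (orthonormal_spike F) (top_le_span_spike F) : OrthonormalBasis (Site (F.P n) 0 × (Fin 2 × Fin 2)) ℂ (SiteL2K ℂ 3 (periodsT3 F n) c₁ W₂)) i)
    (sub_projR_eq_G_lift_coeffSum F h U₀ Q'' ι hι T hT G hAG hGA hmB hcoer)
    (hsrc_of_P3v F h hε₀ hε7 U₀ hreg Q'' hseq ι hι T hT ha G hAG hμ' hδ₁ hδ hwin hCT hCTb hCG hGn hmB hcoer hgap hCpt hκ hcol)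
    hGsup hT1 bd E

end Summit.QuantumFields.YangMills.Theorems.Prop7PcolOfGradientRow

end
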